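import Literature.MathematicalPhysics.QuantumFieldTheory.Balaban1983to89.T4Discrete031Defect
import Literature.MathematicalPhysics.QuantumFieldTheory.Balaban1983to89.T4MatchingAssembly
import Literature.MathematicalPhysics.QuantumFieldTheory.Balaban1983to89.T4TowerRateComposition
import Literature.MathematicalPhysics.QuantumFieldTheory.Balaban1983to89.FlowStepRuns

/-!
# Spine estimate NE7 — THE SLOT'S β-BINDER (node U4′) RE-KEYED TO CUTOFFS `K ≥ K₀` (cell `pub-balaban-gaps`, seat ne7, file 21)

HONEST FRAMING (page 1): bookkeeping over tree theorems on ONE fixed finite torus T⁴ (rung (B)+1 of the cell's ladder);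
NE7 is NOT proved here (spine 0/9); NOT infinite volume, NOT a mass gap, NOT Clay; nothing of Bałaban's is asserted —
the flow window (0.31) p. 259 of [Balaban1987RG1] (tree `Step.Discrete031 b β' K g gs`: `1/g² + b(K−k) ≤ 1/g_k² ≤
1/g² + β'(K−k)`, `k ≤ K`) stays a HYPOTHESIS BINDER everywhere; this file only changes AT WHICH CUTOFFS it is asked.
Every declaration is [folklore] (comparison of series, `summable_nat_add_iff`); NO definitions, no cite tags (page
numbers are LOCATORS); companion of the Literature audit leaf `T4Discrete031Defect` (DEFECTED anchor, every cutoff).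

QUESTION (lens L-8 of seat g1-plan-2 gen 14; typed by seat ne7 gen 7).  Every in-tree constructor of the NE7 slot of
the T⁴ headline keys the β-input of node U4′ as the LITERAL window (0.31) AT EVERY CUTOFF with a fixed lower slope
`b > 0`: `T4MatchingAssembly.hybridNE7_of_slotDom_twoRate_crossover` (`h031 : ∀ K, …`; root
`T4Crossover.summable_crossoverDelta`) and route 1's docked END `NE7Route1EndDocked.goodClause_summable_of_route1_docked`
(`h031A`, `h031B`), which threads the binder unopened down to two call sites, `T4TermwiseResidual.summable_rRadius[_poly]`
(roots `T4Crossover.summable_sum_min_coupling`, `T4TowerRateComposition.summable_sum_min_coupling_poly`).  AS KEYED, the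
window at cutoff `K = 1` pins the FIRST β-value at the tuned bare coupling into `[b, β′]` (§5) — early-index
positivity, which an EVENTUAL floor on the β-function (from an index `k₀` on) does not supply.  AS USED, all three roots
conclude `Summable (K ↦ F (gs K) K)` — COFINITE-INSENSITIVE — and unfold only the LOWER half with the anchor `1/g²`
DROPPED (`T4Discrete031Defect` §3: the anchor-free running `b(K−k) ≤ 1/g_k²`).

RESULT (kernel).  §1 the three roots under the anchor-free lower running asked at cutoffs `K ≥ K₀` ONLY; §2 the
literal-eventual and defected-eventual corollaries; §3 DROP-IN twins of route 1's two call-site lemmas (same explicit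
arguments in the same order, same conclusion, `h031A`/`h031B` for `K ≥ K₀` only — the substitution along route 1's END
chain is its owner's edit, not made here); §4 the slot constructor RE-KEYED (verbatim binders, `h031` eventual in `K`;
the tree's constructor is its case `K₀ = 0`); §5 the small-cutoff reading and two witnesses (necessity of the early sign
for the keyed form; strictness of the weakening); §6 suppliers BY NAME: the tail-grade eventual floor `b ≤ β_k`
(`k ≥ k₀`) + the printed lower bound `−β′` give slope `b/2` at every cutoff `K` with `(3b+2β′)k₀ ≤ bK`
(`FlowStepRuns.discrete031H_lower_of_eventualLower_largeK`); run B's re-indexed table inherits it.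
READING: as keyed today the NE7 slot consumes early-index positivity of the β-function through U4′; as RE-KEYED here it
consumes only an eventual-in-`K`, anchor-free lower running — no sign of any early-index β-value.  NOT here: any
producer of (0.31) or of the floor (the β sub-cell's roads); any edit of the docked END or of `T4TermwiseResidual`.

Reference (LOCATOR only): [Balaban1987RG1] T. Bałaban, Commun. Math. Phys. 109 (1987) 249–301, (0.31) p. 259, (0.20) p. 256.
-/

namespace Summit.QuantumFields.BalabanUV.T4Continuum.Spine.NE7.SlotBetaKeying

open Finset
open Literature.MathematicalPhysics.QuantumFieldTheory.Balaban1983to89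
open Literature.MathematicalPhysics.QuantumFieldTheory.Balaban1983to89.T4Crossover (crossoverDelta)
open Literature.MathematicalPhysics.QuantumFieldTheory.Balaban1983to89.T4MatchingAssembly (HybridNE7
  hybridNE7_of_relWeightBound lt_one_of_lt_exp)
open Literature.MathematicalPhysics.QuantumFieldTheory.Balaban1983to89.T4IndicatorShell (ShellWeightBound)

/-! ## §0 Cofinite insensitivity of `Summable` (the one analytic fact used) -/

/-- A real sequence that is nonnegative and dominated by a summable one FROM SOME INDEX ON is summable
(`Summable.of_nonneg_of_le` on the shifted sequences, `summable_nat_add_iff`). [folklore] -/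
theorem summable_of_eventually_nonneg_le {f g : ℕ → ℝ} (K₀ : ℕ) (h0 : ∀ K, K₀ ≤ K → 0 ≤ f K)
    (hle : ∀ K, K₀ ≤ K → f K ≤ g K) (hg : Summable g) : Summable f := by
  have hg' : Summable (fun n => g (n + K₀)) := (summable_nat_add_iff K₀).2 hg
  have hf' : Summable (fun n => f (n + K₀)) :=
    Summable.of_nonneg_of_le (fun n => h0 _ (Nat.le_add_left K₀ n)) (fun n => hle _ (Nat.le_add_left K₀ n)) hg'
  exact (summable_nat_add_iff K₀).1 hf'

/-! ## §1 The three roots under the EVENTUAL anchor-free lower running -/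

/-- **Crossover sum (ii), summable over `K` — anchor-free lower running AT CUTOFFS `K ≥ K₀` ONLY** (cf.
`T4Crossover.summable_sum_min_coupling`, `T4Discrete031Defect.summable_sum_min_coupling_of_lower`): for `K ≥ K₀`,
`b(K−k) ≤ 1/(gs K k)²` and `0 ≤ gs K k` (`k ≤ K`); `R₁, C ≥ 0`, `0 < θ ≤ Λ`, `σ > 0` with `θ(Λ/θ)^σ < 1`, `κ₀ > 4`.
Nothing is asked of the tables at cutoffs `K < K₀`. [folklore] -/
theorem summable_sum_min_coupling_of_eventuallyLower {b R₁ C θ Λ σ : ℝ} {gs : ℕ → ℕ → ℝ} {κ₀ K₀ : ℕ} (hb : 0 < b)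
    (hlow : ∀ K k : ℕ, K₀ ≤ K → k ≤ K → b * ((K : ℝ) - k) ≤ 1 / (gs K k) ^ 2)
    (hpos : ∀ K k : ℕ, K₀ ≤ K → k ≤ K → 0 ≤ gs K k) (hR₁ : 0 ≤ R₁) (hC : 0 ≤ C) (hθ : 0 < θ) (hθΛ : θ ≤ Λ)
    (hσ : 0 < σ) (hq : θ * (Λ / θ) ^ σ < 1) (hκ : 4 < κ₀) :
    Summable (fun K : ℕ => ∑ p ∈ antidiagonal K, min (R₁ * gs K p.1 ^ κ₀) (C * θ ^ p.1 * Λ ^ p.2)) := by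
  have hr0 : 0 < Λ / θ := div_pos (hθ.trans_le hθΛ) hθ
  have hq0 : 0 ≤ θ * (Λ / θ) ^ σ := mul_nonneg hθ.le (Real.rpow_nonneg hr0.le _)
  have hκ' : (2 : ℝ) < (κ₀ : ℝ) / 2 := by
    have : (4 : ℝ) < κ₀ := by exact_mod_cast hκ
    linarith
  have hA := (T4Crossover.summable_succ_mul_inv_rpow (mul_pos hb hσ) hκ').mul_left R₁
  have hB := (T4CauchySum.summable_succ_pow_mul_geometric hq0 hq 1).mul_left (C * (Λ / θ) ^ σ)
  have hbound : Summable (fun K : ℕ => ((K : ℝ) + 1) *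
      (R₁ * (b * σ * ((K : ℝ) + 1))⁻¹ ^ ((κ₀ : ℝ) / 2) + C * (Λ / θ) ^ σ * (θ * (Λ / θ) ^ σ) ^ K)) := by
    refine (hA.add hB).congr fun K => ?_
    simp only [pow_one]
    ring
  refine summable_of_eventually_nonneg_le K₀ (fun K hK => Finset.sum_nonneg fun p hp => ?_) (fun K hK => ?_) hbound
  · have hj : p.1 ≤ K := by have := mem_antidiagonal.mp hp; omega
    exact le_min (mul_nonneg hR₁ (pow_nonneg (hpos K p.1 hK hj) _))
      (mul_nonneg (mul_nonneg hC (pow_nonneg hθ.le _)) (pow_nonneg (hθ.le.trans hθΛ) _))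
  · exact T4Discrete031Defect.sum_min_coupling_le_of_lower hb (fun k hk => hlow K k hK hk)
      (fun k hk => hpos K k hK hk) hR₁ hC hθ hθΛ hσ

/-- **The R-branch with a POLYNOMIAL rate constant `C·(K+1)^p`, ANCHOR-FREE at every cutoff** (cf.
`T4TowerRateComposition.summable_sum_min_coupling_poly`; the anchor-free form `T4Discrete031Defect` does not list):
the polynomial only multiplies the geometric recent part, `κ₀ > 4` unchanged. [folklore] -/
theorem summable_sum_min_coupling_poly_of_eventuallyLower {b R₁ C θ Λ σ : ℝ} {gs : ℕ → ℕ → ℝ} {κ₀ p K₀ : ℕ}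
    (hb : 0 < b) (hlow : ∀ K k : ℕ, K₀ ≤ K → k ≤ K → b * ((K : ℝ) - k) ≤ 1 / (gs K k) ^ 2)
    (hpos : ∀ K k : ℕ, K₀ ≤ K → k ≤ K → 0 ≤ gs K k) (hR₁ : 0 ≤ R₁) (hC : 0 ≤ C) (hθ : 0 < θ) (hθΛ : θ ≤ Λ)
    (hσ : 0 < σ) (hq : θ * (Λ / θ) ^ σ < 1) (hκ : 4 < κ₀) :
    Summable (fun K : ℕ => ∑ x ∈ antidiagonal K,
      min (R₁ * gs K x.1 ^ κ₀) (C * ((K : ℝ) + 1) ^ p * θ ^ x.1 * Λ ^ x.2)) := by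
  have hr0 : 0 < Λ / θ := div_pos (hθ.trans_le hθΛ) hθ
  have hq0 : 0 ≤ θ * (Λ / θ) ^ σ := mul_nonneg hθ.le (Real.rpow_nonneg hr0.le _)
  have hκ' : (2 : ℝ) < (κ₀ : ℝ) / 2 := by
    have : (4 : ℝ) < κ₀ := by exact_mod_cast hκ
    linarith
  have hA := (T4Crossover.summable_succ_mul_inv_rpow (mul_pos hb hσ) hκ').mul_left R₁
  have hB := (T4CauchySum.summable_succ_pow_mul_geometric hq0 hq (p + 1)).mul_left (C * (Λ / θ) ^ σ)
  have hbound : Summable (fun K : ℕ => ((K : ℝ) + 1) *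
      (R₁ * (b * σ * ((K : ℝ) + 1))⁻¹ ^ ((κ₀ : ℝ) / 2)
        + C * ((K : ℝ) + 1) ^ p * (Λ / θ) ^ σ * (θ * (Λ / θ) ^ σ) ^ K)) := by
    refine (hA.add hB).congr fun K => ?_
    rw [pow_succ]
    ring
  refine summable_of_eventually_nonneg_le K₀ (fun K hK => Finset.sum_nonneg fun x hx => ?_) (fun K hK => ?_) hbound
  · have hj : x.1 ≤ K := by have := mem_antidiagonal.mp hx; omega
    exact le_min (mul_nonneg hR₁ (pow_nonneg (hpos K x.1 hK hj) _))
      (mul_nonneg (mul_nonneg (mul_nonneg hC (by positivity)) (pow_nonneg hθ.le _))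
        (pow_nonneg (hθ.le.trans hθΛ) _))
  · exact T4Discrete031Defect.sum_min_coupling_le_of_lower hb (fun k hk => hlow K k hK hk)
      (fun k hk => hpos K k hK hk) hR₁ (mul_nonneg hC (by positivity)) hθ hθΛ hσ

/-- **`Summable δ` — anchor-free lower running AT CUTOFFS `K ≥ K₀` ONLY** (cf. `T4Crossover.summable_crossoverDelta`,
`T4Discrete031Defect.summable_crossoverDelta_of_lower`): the crossover majorant of node U4′ is summable as soon as the
coupling tables obey `b(K−k) ≤ 1/(gs K k)²`, `0 ≤ gs K k` for `k ≤ K` and `K ≥ K₀`; every other hypothesis and the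
conclusion verbatim. [folklore] -/
theorem summable_crossoverDelta_of_eventuallyLower {E a θ Λ b R₁ C : ℝ} {κ₀ K₀ : ℕ} {gs : ℕ → ℕ → ℝ} {w : ℕ → ℝ}
    (ha0 : 0 < a) (ha1 : a < 1) (hθ : 0 < θ) (hθ1 : θ < 1) (hθΛ : θ ≤ Λ) (hb : 0 < b)
    (hlow : ∀ K k : ℕ, K₀ ≤ K → k ≤ K → b * ((K : ℝ) - k) ≤ 1 / (gs K k) ^ 2)
    (hpos : ∀ K k : ℕ, K₀ ≤ K → k ≤ K → 0 ≤ gs K k)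
    (hR₁ : 0 ≤ R₁) (hC : 0 ≤ C) (hκ : 4 < κ₀) (hw : Summable w) :
    Summable (crossoverDelta E a θ Λ R₁ C κ₀ gs w) := by
  obtain ⟨σ, hσ, hq⟩ := T4Crossover.exists_recentRate_lt_one hθ hθ1 hθΛ
  exact (((T4Crossover.summable_sum_min_pow ha0 ha1 hθ hθ1 hθΛ).mul_left E).add
    (summable_sum_min_coupling_of_eventuallyLower hb hlow hpos hR₁ hC hθ hθΛ hσ hq hκ)).add hw

/-! ## §2 The literal-eventual and defected-eventual corollaries -/

/-- The anchor-free lower running at cutoffs `K ≥ K₀` from the LITERAL (0.31) at cutoffs `K ≥ K₀`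
(`T4Discrete031Defect.lower_noAnchor_of_discrete031`). [folklore] -/
theorem eventuallyLower_of_eventually031 {b β' : ℝ} {K₀ : ℕ} {g : ℕ → ℝ} {gs : ℕ → ℕ → ℝ}
    (h031 : ∀ K, K₀ ≤ K → Step.Discrete031 b β' K (g K) (gs K)) :
    ∀ K k : ℕ, K₀ ≤ K → k ≤ K → b * ((K : ℝ) - k) ≤ 1 / (gs K k) ^ 2 :=
  fun K _ hK hk => T4Discrete031Defect.lower_noAnchor_of_discrete031 (h031 K hK) hk

/-- The anchor-free lower running at cutoffs `K ≥ K₀` from the DEFECTED running at cutoffs `K ≥ K₀` with `D_K ≤ 1/g_K²`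
(`T4Discrete031Defect.Defect.lower_noAnchor`). [folklore] -/
theorem eventuallyLower_of_eventuallyDefect {b β' : ℝ} {K₀ : ℕ} {D g : ℕ → ℝ} {gs : ℕ → ℕ → ℝ}
    (hdef : ∀ K, K₀ ≤ K → T4Discrete031Defect.Defect b β' (D K) K (g K) (gs K))
    (hD1 : ∀ K, K₀ ≤ K → D K ≤ 1 / (g K) ^ 2) :
    ∀ K k : ℕ, K₀ ≤ K → k ≤ K → b * ((K : ℝ) - k) ≤ 1 / (gs K k) ^ 2 :=
  fun K _ hK hk => (hdef K hK).lower_noAnchor (hD1 K hK) hk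

/-- **`Summable δ` FROM THE LITERAL (0.31) AT CUTOFFS `K ≥ K₀` ONLY** — `T4Crossover.summable_crossoverDelta` with
`h031` asked eventually in `K`; conclusion and constants verbatim. [folklore] -/
theorem summable_crossoverDelta_of_eventually031 {E a θ Λ b β' R₁ C : ℝ} {κ₀ K₀ : ℕ} {g : ℕ → ℝ} {gs : ℕ → ℕ → ℝ}
    {w : ℕ → ℝ} (ha0 : 0 < a) (ha1 : a < 1) (hθ : 0 < θ) (hθ1 : θ < 1) (hθΛ : θ ≤ Λ) (hb : 0 < b)
    (h031 : ∀ K, K₀ ≤ K → Step.Discrete031 b β' K (g K) (gs K)) (hpos : ∀ K k, k ≤ K → 0 ≤ gs K k) (hR₁ : 0 ≤ R₁)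
    (hC : 0 ≤ C) (hκ : 4 < κ₀) (hw : Summable w) :
    Summable (crossoverDelta E a θ Λ R₁ C κ₀ gs w) :=
  summable_crossoverDelta_of_eventuallyLower ha0 ha1 hθ hθ1 hθΛ hb (eventuallyLower_of_eventually031 h031)
    (fun K k _ hk => hpos K k hk) hR₁ hC hκ hw

/-- **`Summable δ` FROM THE DEFECTED RUNNING AT CUTOFFS `K ≥ K₀` ONLY** (`D_K ≤ 1/g_K²` there) —
`T4Discrete031Defect.summable_crossoverDelta_of_defect` asked eventually in `K`. [folklore] -/
theorem summable_crossoverDelta_of_eventuallyDefect {E a θ Λ b β' R₁ C : ℝ} {κ₀ K₀ : ℕ} {D g : ℕ → ℝ}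
    {gs : ℕ → ℕ → ℝ} {w : ℕ → ℝ} (ha0 : 0 < a) (ha1 : a < 1) (hθ : 0 < θ) (hθ1 : θ < 1) (hθΛ : θ ≤ Λ)
    (hb : 0 < b) (hdef : ∀ K, K₀ ≤ K → T4Discrete031Defect.Defect b β' (D K) K (g K) (gs K))
    (hD1 : ∀ K, K₀ ≤ K → D K ≤ 1 / (g K) ^ 2) (hpos : ∀ K k, k ≤ K → 0 ≤ gs K k) (hR₁ : 0 ≤ R₁) (hC : 0 ≤ C)
    (hκ : 4 < κ₀) (hw : Summable w) :
    Summable (crossoverDelta E a θ Λ R₁ C κ₀ gs w) :=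
  summable_crossoverDelta_of_eventuallyLower ha0 ha1 hθ hθ1 hθΛ hb (eventuallyLower_of_eventuallyDefect hdef hD1)
    (fun K k _ hk => hpos K k hk) hR₁ hC hκ hw

/-! ## §3 Route 1's two call-site lemmas, re-keyed (drop-in twins of `T4TermwiseResidual.summable_rRadius[_poly]`) -/

/-- **`Σ_K rρ_K < ∞`, the 𝐑-radius with a `K`-uniform rate constant — (0.31) AT CUTOFFS `K ≥ K₀` ONLY, both runs.**
The statement of `T4TermwiseResidual.summable_rRadius` VERBATIM (same explicit arguments in the same order, same
conclusion) except that `h031A`, `h031B` are asked for `K ≥ K₀`; a textual drop-in at its two call sites. [folklore] -/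
theorem summable_rRadius_of_eventually031 {b β' R₁ CrR θ Λ Cw : ℝ} {gfA gfB : ℕ → ℝ} {gsA gsB : ℕ → ℕ → ℝ}
    {κ₀ K₀ : ℕ} (hb : 0 < b) (h031A : ∀ K, K₀ ≤ K → Step.Discrete031 b β' K (gfA K) (gsA K))
    (h031B : ∀ K, K₀ ≤ K → Step.Discrete031 b β' K (gfB K) (gsB K)) (hgsA : ∀ K k, k ≤ K → 0 ≤ gsA K k)
    (hgsB : ∀ K k, k ≤ K → 0 ≤ gsB K k) (hR₁ : 0 ≤ R₁) (hCrR : 0 ≤ CrR) (hθ : 0 < θ) (hθ1 : θ < 1) (hθΛ : θ ≤ Λ)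
    (hκ₀ : 4 < κ₀) :
    Summable (fun K => max (2 * Cw) 1 * ((∑ p ∈ antidiagonal K, min (R₁ * gsA K p.1 ^ κ₀) (CrR * θ ^ p.1 * Λ ^ p.2))
      + ∑ p ∈ antidiagonal K, min (R₁ * gsB K p.1 ^ κ₀) (CrR * θ ^ p.1 * Λ ^ p.2))) := by
  obtain ⟨σ, hσ, hq⟩ := T4Crossover.exists_recentRate_lt_one hθ hθ1 hθΛ
  exact ((summable_sum_min_coupling_of_eventuallyLower hb (eventuallyLower_of_eventually031 h031A)
      (fun K k _ hk => hgsA K k hk) hR₁ hCrR hθ hθΛ hσ hq hκ₀).add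
    (summable_sum_min_coupling_of_eventuallyLower hb (eventuallyLower_of_eventually031 h031B)
      (fun K k _ hk => hgsB K k hk) hR₁ hCrR hθ hθΛ hσ hq hκ₀)).mul_left _

/-- **The same with a POLYNOMIALLY GROWING rate constant `C_R·(K+1)^p`** — the statement of
`T4TermwiseResidual.summable_rRadius_poly` VERBATIM except that `h031A`, `h031B` are asked for `K ≥ K₀`. [folklore] -/
theorem summable_rRadius_poly_of_eventually031 {b β' R₁ CrR θ Λ Cw : ℝ} {gfA gfB : ℕ → ℝ} {gsA gsB : ℕ → ℕ → ℝ}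
    {κ₀ p K₀ : ℕ} (hb : 0 < b) (h031A : ∀ K, K₀ ≤ K → Step.Discrete031 b β' K (gfA K) (gsA K))
    (h031B : ∀ K, K₀ ≤ K → Step.Discrete031 b β' K (gfB K) (gsB K)) (hgsA : ∀ K k, k ≤ K → 0 ≤ gsA K k)
    (hgsB : ∀ K k, k ≤ K → 0 ≤ gsB K k) (hR₁ : 0 ≤ R₁) (hCrR : 0 ≤ CrR) (hθ : 0 < θ) (hθ1 : θ < 1) (hθΛ : θ ≤ Λ)
    (hκ₀ : 4 < κ₀) :
    Summable (fun K => max (2 * Cw) 1 *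
      ((∑ x ∈ antidiagonal K, min (R₁ * gsA K x.1 ^ κ₀) (CrR * ((K : ℝ) + 1) ^ p * θ ^ x.1 * Λ ^ x.2))
        + ∑ x ∈ antidiagonal K, min (R₁ * gsB K x.1 ^ κ₀) (CrR * ((K : ℝ) + 1) ^ p * θ ^ x.1 * Λ ^ x.2))) := by
  obtain ⟨σ, hσ, hq⟩ := T4Crossover.exists_recentRate_lt_one hθ hθ1 hθΛ
  exact ((summable_sum_min_coupling_poly_of_eventuallyLower hb (eventuallyLower_of_eventually031 h031A)
      (fun K k _ hk => hgsA K k hk) hR₁ hCrR hθ hθΛ hσ hq hκ₀ (p := p)).add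
    (summable_sum_min_coupling_poly_of_eventuallyLower hb (eventuallyLower_of_eventually031 h031B)
      (fun K k _ hk => hgsB K k hk) hR₁ hCrR hθ hθΛ hσ hq hκ₀ (p := p))).mul_left _

/-- **The 𝐑-radius from the WEAKEST form both call sites tolerate**: the anchor-free lower running and nonnegativity of
BOTH runs' tables at cutoffs `K ≥ K₀` only (this is what a defected or averaged-AF supplier delivers, §2/§6). [folklore] -/
theorem summable_rRadius_of_eventuallyLower {b R₁ CrR θ Λ Cw : ℝ} {gsA gsB : ℕ → ℕ → ℝ} {κ₀ K₀ : ℕ} (hb : 0 < b)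
    (hlowA : ∀ K k : ℕ, K₀ ≤ K → k ≤ K → b * ((K : ℝ) - k) ≤ 1 / (gsA K k) ^ 2)
    (hlowB : ∀ K k : ℕ, K₀ ≤ K → k ≤ K → b * ((K : ℝ) - k) ≤ 1 / (gsB K k) ^ 2)
    (hgsA : ∀ K k : ℕ, K₀ ≤ K → k ≤ K → 0 ≤ gsA K k) (hgsB : ∀ K k : ℕ, K₀ ≤ K → k ≤ K → 0 ≤ gsB K k)
    (hR₁ : 0 ≤ R₁) (hCrR : 0 ≤ CrR) (hθ : 0 < θ) (hθ1 : θ < 1) (hθΛ : θ ≤ Λ) (hκ₀ : 4 < κ₀) :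
    Summable (fun K => max (2 * Cw) 1 * ((∑ p ∈ antidiagonal K, min (R₁ * gsA K p.1 ^ κ₀) (CrR * θ ^ p.1 * Λ ^ p.2))
      + ∑ p ∈ antidiagonal K, min (R₁ * gsB K p.1 ^ κ₀) (CrR * θ ^ p.1 * Λ ^ p.2))) := by
  obtain ⟨σ, hσ, hq⟩ := T4Crossover.exists_recentRate_lt_one hθ hθ1 hθΛ
  exact ((summable_sum_min_coupling_of_eventuallyLower hb hlowA hgsA hR₁ hCrR hθ hθΛ hσ hq hκ₀).add
    (summable_sum_min_coupling_of_eventuallyLower hb hlowB hgsB hR₁ hCrR hθ hθΛ hσ hq hκ₀)).mul_left _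

/-! ## §4 The NE7 slot constructor re-keyed (`T4MatchingAssembly.hybridNE7_of_slotDom_twoRate_crossover`) -/

section Slot

variable {ι : Type*} [DecidableEq ι] {l₀ vol : ℝ} {T : ℕ → Finset ι} {A B shA shB : ℕ → ℝ → ι → ℝ}
  {Bad : ℕ → ℝ → Finset ι} {Wsh : ℕ → ℝ}

/-- **THE NE7 SLOT FROM THE WEAKEST β-INPUT ITS ROOT TOLERATES**: `T4MatchingAssembly.hybridNE7_of_slotDom_twoRate_crossover`
with the pair `h031`/`hgs` replaced by the anchor-free lower running and nonnegativity of the tables at cutoffs `K ≥ K₀`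
only; every other binder, the weight `1 − exp(−S_K)` and the remainder `crossoverDelta …` verbatim. [folklore] -/
theorem hybridNE7_of_slotDom_twoRate_crossover_eventuallyLower {E a θ Λ b R₁ C : ℝ} {κ₀ K₀ : ℕ}
    {gs : ℕ → ℕ → ℝ} {w : ℕ → ℝ} {Cs V r c : ℝ} {jstar : ℕ → ℕ}
    (ha0 : 0 < a) (ha1 : a < 1) (hθ : 0 < θ) (hθ1 : θ < 1) (hθΛ : θ ≤ Λ) (hb : 0 < b)
    (hlow : ∀ K k : ℕ, K₀ ≤ K → k ≤ K → b * ((K : ℝ) - k) ≤ 1 / (gs K k) ^ 2)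
    (hgs : ∀ K k : ℕ, K₀ ≤ K → k ≤ K → 0 ≤ gs K k) (hR₁ : 0 ≤ R₁) (hC : 0 ≤ C) (hκ : 4 < κ₀) (hw : Summable w)
    (hCs : 0 ≤ Cs) (hV : 0 ≤ V) (h0 : 0 < r) (h1 : r < 1) (hc : 0 < c)
    (hfrac : ∀ K : ℕ, c * K ≤ ((K - jstar K : ℕ) : ℝ))
    (hA : ∀ K t, |t| ≤ l₀ → ∀ τ ∈ T K, 0 ≤ A K t τ) (hB : ∀ K t, |t| ≤ l₀ → ∀ τ ∈ T K, 0 ≤ B K t τ)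
    (hDA : T4HistoryPeeling.SlotDom l₀ T A Bad fun K => Cs * V * (r ^ (K - jstar K + 1) / (1 - r)))
    (hDB : T4HistoryPeeling.SlotDom l₀ T B Bad fun K => Cs * V * (r ^ (K - jstar K + 1) / (1 - r)))
    (hSh : ShellWeightBound l₀ T A B shA shB Wsh)
    (hlt : ∀ K, Wsh K < Real.exp (-(Cs * V * (r ^ (K - jstar K + 1) / (1 - r)))))
    (hcore : ∀ K : ℕ, ∃ c₀ : ℝ, ∀ t : ℝ, |t| ≤ l₀ → ∀ τ ∈ T K \ Bad K t,
      Real.exp (c₀ - vol * crossoverDelta E a θ Λ R₁ C κ₀ gs w K) * (A K t τ - shA K t τ) ≤ B K t τ - shB K t τ ∧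
        B K t τ - shB K t τ ≤ Real.exp (c₀ + vol * crossoverDelta E a θ Λ R₁ C κ₀ gs w K) * (A K t τ - shA K t τ)) :
    HybridNE7 l₀ vol T A B Bad (fun K => 1 - Real.exp (-(Cs * V * (r ^ (K - jstar K + 1) / (1 - r))))) shA shB Wsh
      (crossoverDelta E a θ Λ R₁ C κ₀ gs w) :=
  hybridNE7_of_relWeightBound (T4HistoryPeeling.relWeightBound_of_slotDom_twoRate hCs hV h0 h1 hc hfrac hA hB hDA hDB)
    hSh (lt_one_of_lt_exp hlt)
    (summable_crossoverDelta_of_eventuallyLower ha0 ha1 hθ hθ1 hθΛ hb hlow hgs hR₁ hC hκ hw) hcore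

/-- **THE NE7 SLOT CONSTRUCTOR RE-KEYED**: `T4MatchingAssembly.hybridNE7_of_slotDom_twoRate_crossover` VERBATIM (same
binders in the same order, same conclusion) except `h031 : ∀ K, K₀ ≤ K → Step.Discrete031 b β' K (g K) (gs K)` — the flow
window (0.31) at cutoffs `K ≥ K₀` only.  Its only use there is `summable_crossoverDelta`; here §2's eventual form.
(The shape of this re-keying is lens L-8 of seat g1-plan-2 of the cell `pub-balaban-gaps`.) [folklore] -/
theorem hybridNE7_of_slotDom_twoRate_crossover_eventually031 {E a θ Λ b β' R₁ C : ℝ} {κ₀ K₀ : ℕ} {g : ℕ → ℝ}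
    {gs : ℕ → ℕ → ℝ} {w : ℕ → ℝ} {Cs V r c : ℝ} {jstar : ℕ → ℕ}
    (ha0 : 0 < a) (ha1 : a < 1) (hθ : 0 < θ) (hθ1 : θ < 1) (hθΛ : θ ≤ Λ) (hb : 0 < b)
    (h031 : ∀ K, K₀ ≤ K → Step.Discrete031 b β' K (g K) (gs K)) (hgs : ∀ K k, k ≤ K → 0 ≤ gs K k) (hR₁ : 0 ≤ R₁)
    (hC : 0 ≤ C) (hκ : 4 < κ₀) (hw : Summable w)
    (hCs : 0 ≤ Cs) (hV : 0 ≤ V) (h0 : 0 < r) (h1 : r < 1) (hc : 0 < c)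
    (hfrac : ∀ K : ℕ, c * K ≤ ((K - jstar K : ℕ) : ℝ))
    (hA : ∀ K t, |t| ≤ l₀ → ∀ τ ∈ T K, 0 ≤ A K t τ) (hB : ∀ K t, |t| ≤ l₀ → ∀ τ ∈ T K, 0 ≤ B K t τ)
    (hDA : T4HistoryPeeling.SlotDom l₀ T A Bad fun K => Cs * V * (r ^ (K - jstar K + 1) / (1 - r)))
    (hDB : T4HistoryPeeling.SlotDom l₀ T B Bad fun K => Cs * V * (r ^ (K - jstar K + 1) / (1 - r)))
    (hSh : ShellWeightBound l₀ T A B shA shB Wsh)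
    (hlt : ∀ K, Wsh K < Real.exp (-(Cs * V * (r ^ (K - jstar K + 1) / (1 - r)))))
    (hcore : ∀ K : ℕ, ∃ c₀ : ℝ, ∀ t : ℝ, |t| ≤ l₀ → ∀ τ ∈ T K \ Bad K t,
      Real.exp (c₀ - vol * crossoverDelta E a θ Λ R₁ C κ₀ gs w K) * (A K t τ - shA K t τ) ≤ B K t τ - shB K t τ ∧
        B K t τ - shB K t τ ≤ Real.exp (c₀ + vol * crossoverDelta E a θ Λ R₁ C κ₀ gs w K) * (A K t τ - shA K t τ)) :
    HybridNE7 l₀ vol T A B Bad (fun K => 1 - Real.exp (-(Cs * V * (r ^ (K - jstar K + 1) / (1 - r))))) shA shB Wsh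
      (crossoverDelta E a θ Λ R₁ C κ₀ gs w) :=
  hybridNE7_of_slotDom_twoRate_crossover_eventuallyLower ha0 ha1 hθ hθ1 hθΛ hb (eventuallyLower_of_eventually031 h031)
    (fun K k _ hk => hgs K k hk) hR₁ hC hκ hw hCs hV h0 h1 hc hfrac hA hB hDA hDB hSh hlt hcore

/-- NOTHING IS LOST (sanity `example`, not a declaration: the statement IS the tree's keyed constructor
`T4MatchingAssembly.hybridNE7_of_slotDom_twoRate_crossover`): the keyed form is the case `K₀ = 0` of the re-keyed one. -/
example {E a θ Λ b β' R₁ C : ℝ} {κ₀ : ℕ} {g : ℕ → ℝ}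
    {gs : ℕ → ℕ → ℝ} {w : ℕ → ℝ} {Cs V r c : ℝ} {jstar : ℕ → ℕ}
    (ha0 : 0 < a) (ha1 : a < 1) (hθ : 0 < θ) (hθ1 : θ < 1) (hθΛ : θ ≤ Λ) (hb : 0 < b)
    (h031 : ∀ K, Step.Discrete031 b β' K (g K) (gs K)) (hgs : ∀ K k, k ≤ K → 0 ≤ gs K k) (hR₁ : 0 ≤ R₁)
    (hC : 0 ≤ C) (hκ : 4 < κ₀) (hw : Summable w)
    (hCs : 0 ≤ Cs) (hV : 0 ≤ V) (h0 : 0 < r) (h1 : r < 1) (hc : 0 < c)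
    (hfrac : ∀ K : ℕ, c * K ≤ ((K - jstar K : ℕ) : ℝ))
    (hA : ∀ K t, |t| ≤ l₀ → ∀ τ ∈ T K, 0 ≤ A K t τ) (hB : ∀ K t, |t| ≤ l₀ → ∀ τ ∈ T K, 0 ≤ B K t τ)
    (hDA : T4HistoryPeeling.SlotDom l₀ T A Bad fun K => Cs * V * (r ^ (K - jstar K + 1) / (1 - r)))
    (hDB : T4HistoryPeeling.SlotDom l₀ T B Bad fun K => Cs * V * (r ^ (K - jstar K + 1) / (1 - r)))
    (hSh : ShellWeightBound l₀ T A B shA shB Wsh)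
    (hlt : ∀ K, Wsh K < Real.exp (-(Cs * V * (r ^ (K - jstar K + 1) / (1 - r)))))
    (hcore : ∀ K : ℕ, ∃ c₀ : ℝ, ∀ t : ℝ, |t| ≤ l₀ → ∀ τ ∈ T K \ Bad K t,
      Real.exp (c₀ - vol * crossoverDelta E a θ Λ R₁ C κ₀ gs w K) * (A K t τ - shA K t τ) ≤ B K t τ - shB K t τ ∧
        B K t τ - shB K t τ ≤ Real.exp (c₀ + vol * crossoverDelta E a θ Λ R₁ C κ₀ gs w K) * (A K t τ - shA K t τ)) :
    HybridNE7 l₀ vol T A B Bad (fun K => 1 - Real.exp (-(Cs * V * (r ^ (K - jstar K + 1) / (1 - r))))) shA shB Wsh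
      (crossoverDelta E a θ Λ R₁ C κ₀ gs w) :=
  hybridNE7_of_slotDom_twoRate_crossover_eventually031 (K₀ := 0) ha0 ha1 hθ hθ1 hθΛ hb (fun K _ => h031 K) hgs hR₁ hC
    hκ hw hCs hV h0 h1 hc hfrac hA hB hDA hDB hSh hlt hcore

end Slot

/-! ## §5 What the keyed form says at small cutoff; two witnesses -/

/-- Along a solution of (0.20) up to cutoff `K ≥ 1`, the keyed window at level `K − 1` says the LAST step's β-value is
`≥ b` (locator: [Balaban1987RG1] (0.31) p. 259, (0.20) p. 256). [folklore] -/
theorem lastBeta_ge_of_discrete031 {β : FlowStep.HBeta} {K : ℕ} {gs : ℕ → ℝ} {b β' : ℝ} (hK : 1 ≤ K)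
    (hrg : FlowStep.RGEqH K β gs) (h : Step.Discrete031 b β' K (gs K) gs) :
    b ≤ β (K - 1) (FlowStep.prefixOf gs (K - 1)) := by
  have hstep := hrg (K - 1) (by omega)
  have hKs : K - 1 + 1 = K := by omega
  rw [hKs] at hstep
  have hlow := (h (K - 1) (by omega)).1
  have e : ((K : ℝ) - ((K - 1 : ℕ) : ℝ)) = 1 := by
    rw [Nat.cast_sub hK]; push_cast; ring
  rw [e, mul_one] at hlow
  linarith

/-- AS KEYED, at cutoff `K = 1` the window pins the FIRST β-value at the tuned bare coupling into `[b, β′]` — with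
`0 < b` this is early-index POSITIVITY of the β-function (the currency of the cell's row CAP), which an eventual floor
from some index `k₀ ≥ 1` on does not supply. [folklore] -/
theorem firstBeta_mem_of_discrete031_one {β : FlowStep.HBeta} {gs : ℕ → ℝ} {b β' : ℝ}
    (hrg : FlowStep.RGEqH 1 β gs) (h : Step.Discrete031 b β' 1 (gs 1) gs) :
    b ≤ β 0 (FlowStep.prefixOf gs 0) ∧ β 0 (FlowStep.prefixOf gs 0) ≤ β' := by
  refine ⟨by simpa using lastBeta_ge_of_discrete031 (K := 1) le_rfl hrg h, ?_⟩
  have hstep := hrg 0 (by omega)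
  have hup := (h 0 (by omega)).2
  simp only [Nat.cast_one, Nat.cast_zero, sub_zero, mul_one] at hup
  linarith

/-- WITNESS (necessity of the early sign for the KEYED form): the one-step table `g_0 = 2`, `g_1 = g = 1` violates the
keyed window at `K = 1` for EVERY `b ≥ 0` and every `β′`. [folklore] -/
theorem keyed_fails_at_one : ∀ b β' : ℝ, 0 ≤ b →
    ¬ Step.Discrete031 b β' 1 1 (fun k => if k = 0 then (2 : ℝ) else 1) := by
  intro b β' hb h
  have h0 := (h 0 (by omega)).1
  norm_num at h0
  linarith

/-- WITNESS (the eventual hypothesis is STRICTLY weaker): a family of tables whose cutoff-`0` entry is negative — so even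
nonnegativity, let alone (0.31), fails at `K = 0 < K₀ = 1` — and which satisfies §1's hypotheses from `K₀ = 1` on. [folklore] -/
theorem eventually_strictly_weaker : ∃ gs : ℕ → ℕ → ℝ,
    (¬ ∀ K k : ℕ, k ≤ K → 0 ≤ gs K k) ∧
    (∀ K k : ℕ, 1 ≤ K → k ≤ K → (1 : ℝ) * ((K : ℝ) - k) ≤ 1 / (gs K k) ^ 2) ∧
    (∀ K k : ℕ, 1 ≤ K → k ≤ K → 0 ≤ gs K k) := by
  refine ⟨fun K k => if K = 0 then -1 else Real.sqrt (1 / ((K : ℝ) - k + 1)), ?_, ?_, ?_⟩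
  · intro h; have := h 0 0 le_rfl; norm_num at this
  · intro K k hK hk
    have hK0 : K ≠ 0 := by omega
    simp only [if_neg hK0, one_mul]
    have hKk : 0 ≤ (K : ℝ) - k := sub_nonneg.2 (by exact_mod_cast hk)
    have hden : 0 < (K : ℝ) - k + 1 := by linarith
    rw [Real.sq_sqrt (one_div_pos.2 hden).le, one_div_one_div]
    linarith
  · intro K k hK _
    have hK0 : K ≠ 0 := by omega
    simp only [if_neg hK0]; exact Real.sqrt_nonneg _

/-! ## §6 Suppliers of the eventual anchor-free lower running, BY NAME -/

/-- **THE TAIL GRADE SUFFICES (composition, no new estimate).**  A family of runs `gs K` solving (0.20) up to cutoff `K`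
with prefixes in the box, an EVENTUAL floor `b ≤ β_k` on the boxes from index `k₀` on, and the printed lower bound `−β′`:
at every cutoff `K ≥ K₀` with `(3b + 2β′)k₀ ≤ bK₀` the anchor-free lower running holds with slope `b/2`
(`FlowStepRuns.discrete031H_lower_of_eventualLower_largeK`, its anchor `1/g_K² ≥ 0` dropped) — exactly §1's `hlow`.
No sign of any β-value of index `< k₀` is consumed. [folklore] -/
theorem eventuallyLower_of_eventualFloor {β : FlowStep.HBeta} {gs : ℕ → ℕ → ℝ} {γ₀ b β' : ℝ} {k₀ K₀ : ℕ}
    (hb : 0 ≤ b) (hβ' : 0 ≤ β') (hrg : ∀ K, FlowStep.RGEqH K β (gs K))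
    (hbox : ∀ K j, j < K → FlowStep.prefixOf (gs K) j ∈ FlowStep.Box γ₀ j)
    (htail : ∀ k, k₀ ≤ k → ∀ v ∈ FlowStep.Box γ₀ k, b ≤ β k v) (hlo : ∀ k, ∀ v ∈ FlowStep.Box γ₀ k, -β' ≤ β k v)
    (hK₀ : (3 * b + 2 * β') * k₀ ≤ b * K₀) :
    ∀ K k : ℕ, K₀ ≤ K → k ≤ K → b / 2 * ((K : ℝ) - k) ≤ 1 / (gs K k) ^ 2 := by
  intro K k hK hk
  have hKK : (3 * b + 2 * β') * k₀ ≤ b * K :=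
    hK₀.trans (mul_le_mul_of_nonneg_left (by exact_mod_cast hK) hb)
  have h := FlowStepRuns.discrete031H_lower_of_eventualLower_largeK hb hβ' (hrg K) (hbox K) htail hlo hKK k hk
  have h0 : 0 ≤ 1 / (gs K K) ^ 2 := by positivity
  linarith

/-- Run B's table in run A's numbering (`j ↦ gs (K+1) (j+1)`, cf. `T4TermwiseResidual.discrete031_reindex`) inherits the
eventual anchor-free lower running (`(K+1) − (j+1) = K − j`). [folklore] -/
theorem eventuallyLower_reindex {b : ℝ} {K₀ : ℕ} {gs : ℕ → ℕ → ℝ}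
    (hlow : ∀ K k : ℕ, K₀ ≤ K → k ≤ K → b * ((K : ℝ) - k) ≤ 1 / (gs K k) ^ 2) :
    ∀ K k : ℕ, K₀ ≤ K → k ≤ K → b * ((K : ℝ) - k) ≤ 1 / (gs (K + 1) (k + 1)) ^ 2 := by
  intro K k hK hk
  have h := hlow (K + 1) (k + 1) (by omega) (by omega)
  have e : ((K + 1 : ℕ) : ℝ) - ((k + 1 : ℕ) : ℝ) = (K : ℝ) - k := by push_cast; ring
  rwa [e] at h

/-- **U4′ FOR THE NE7 SLOT FROM THE TAIL GRADE, END TO END** (§6 ∘ §1 with slope `b/2`): eventual floor from `k₀` on +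
printed lower bound `−β′` + `0 < b` + nonnegative couplings from `K₀` on ⇒ `Summable (crossoverDelta …)`. [folklore] -/
theorem summable_crossoverDelta_of_eventualFloor {β : FlowStep.HBeta} {gs : ℕ → ℕ → ℝ} {γ₀ b β' E a θ Λ R₁ C : ℝ}
    {k₀ K₀ κ₀ : ℕ} {w : ℕ → ℝ} (ha0 : 0 < a) (ha1 : a < 1) (hθ : 0 < θ) (hθ1 : θ < 1) (hθΛ : θ ≤ Λ) (hb : 0 < b)
    (hβ' : 0 ≤ β') (hrg : ∀ K, FlowStep.RGEqH K β (gs K))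
    (hbox : ∀ K j, j < K → FlowStep.prefixOf (gs K) j ∈ FlowStep.Box γ₀ j)
    (htail : ∀ k, k₀ ≤ k → ∀ v ∈ FlowStep.Box γ₀ k, b ≤ β k v) (hlo : ∀ k, ∀ v ∈ FlowStep.Box γ₀ k, -β' ≤ β k v)
    (hK₀ : (3 * b + 2 * β') * k₀ ≤ b * K₀) (hpos : ∀ K k : ℕ, K₀ ≤ K → k ≤ K → 0 ≤ gs K k)
    (hR₁ : 0 ≤ R₁) (hC : 0 ≤ C) (hκ : 4 < κ₀) (hw : Summable w) :
    Summable (crossoverDelta E a θ Λ R₁ C κ₀ gs w) :=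
  summable_crossoverDelta_of_eventuallyLower ha0 ha1 hθ hθ1 hθΛ (half_pos hb)
    (eventuallyLower_of_eventualFloor hb.le hβ' hrg hbox htail hlo hK₀) hpos hR₁ hC hκ hw

end Summit.QuantumFields.BalabanUV.T4Continuum.Spine.NE7.SlotBetaKeying
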